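import Summits.FinalStateConjecture.FinalStateConjecture.Theorems.BartnikGapSettlingBondiBartnikRigiditySlabCauchyRigidityDefs
import Literature.Geometry.Lorentzian.HypersurfaceNaturality
import Literature.Geometry.Lorentzian.ChartSecondFundamentalForm
import Literature.Geometry.Lorentzian.MultiCentreKerrSchild
import HarnessLib

/-!
# F1' `stub_slabCauchyRigidity'`, step (b) at order `1`, Kerr side: the slab second fundamental form
# of the Kerr star chart in the coordinates of a boosted collar background — line
# `direct-method-on-the-cone`, crux `BondiBartnikRigidity` (stmt-FinalStateConjecture-10807);
# module 7 of the landing of the conditional proof of F1'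

The Kerr-side half of the second fundamental form identity (A2k) of route statement (A)
`F1Route.SlabSubdatum` (`…SlabCauchyRigidityDefs.lean`):

* `kerrSlab_secondFundamentalForm_chart` — for `B` the star background boosted by `(Λ, c)`, the
  second fundamental form `K_{ν_N}(ψ_N)` of the open slab `y ↦ (0, y)` in the Kerr star chart, with
  its future unit normal `ν_N = (1 + 2H)^{-1/2} V`, is, at `y` and on `v, w ∈ E3`,
  `g_B(x)(D(ΛN)(y) v, Λ(0,w)) + ½ 𝒦_{g_B}(x)(ΛN(y); Λ(0,v), Λ(0,w))`, `x = Λ(0,y) + c`, where `𝒦` is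
  the Koszul form of the COMPONENTS `g_B` (`OpensChart.koszulForm`): a metric-free expression in the
  `1`-jet of `g_B` at the slab point.  Proof: reparametrise the slab over the chart domain
  `{M < r(0,·) < 3M} ⊆ E3` (`secondFundamentalForm_comp_right`), transport through the Poincaré
  isometry `x ↦ Λ⁻¹(x − c)` of `B.domain` onto the star chart (`secondFundamentalForm_comap`), read
  the result in coordinates (`OpensChart.secondFundamentalForm_eq_of_repr`) and expand the
  Christoffel term (`OpensChart.two_mul_val_christoffel`).
* `secondFundamentalForm_congr_pair`, `val_add_christoffel_eq` — two generic rewriting lemmas;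
  `exists_bound_of_injective`, `nondegenerate_of_norm_sub_lt` — two norm lemmas used by the
  development side.

The development-side half and the identity itself are the companion modules
`…SlabCauchyRigiditySecondFormChart.lean`, `…SlabCauchyRigiditySecondForm.lean`.  Registered
bookkeeping sub-goal of the line: `stub_kerrSlabSecondFormChart`.

References: O'Neill 1983, Ch. 3, Prop. 3.13 and Ch. 4, Lemma 4.1 [ONeill1983]; Cook 2000, §3.2.2
(Kerr–Schild lapse and shift).  No definitions, no named facts.
-/

noncomputable section

-- D-0017: single-problem summit, `Summit.<S>.<S>.…` by design (cf. lakefile `weak.linter.dupNamespace`).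
set_option linter.dupNamespace false
set_option maxSynthPendingDepth 3

open Set Filter Function Topology TopologicalSpace Bundle
open Literature.Geometry.Lorentzian
open scoped Manifold ContDiff Topology ENNReal

namespace Summit.FinalStateConjecture.FinalStateConjecture.Theorems.BondiBartnikRigidity.DirectMethod

namespace F1Route

/-! ### Two generic rewriting lemmas -/

section Generic

variable {E : Type*} [NormedAddCommGroup E] [NormedSpace ℝ E] {H : Type*} [TopologicalSpace H]
  {I : ModelWithCorners ℝ E H} {n : ℕ∞ω} {M : Type*} [TopologicalSpace M] [ChartedSpace H M]
  [IsManifold I ∞ M] [FiniteDimensional ℝ E]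
  (g : PseudoRiemannianMetric I n E (TangentSpace I : M → Type _)) [g.HasLeviCivita]
  {E' : Type*} [NormedAddCommGroup E'] [NormedSpace ℝ E'] {H' : Type*} [TopologicalSpace H']
  (I' : ModelWithCorners ℝ E' H') {N : Type*} [TopologicalSpace N] [ChartedSpace H' N]
  [FiniteDimensional ℝ E']

/-- The second fundamental form of `(f, ν)` only depends on the pair: congruence under `f₁ = f₂`
and pointwise equality of the normal fields (all tangent spaces are the model space). [folklore] -/
theorem secondFundamentalForm_congr_pair {f₁ f₂ : N → M} (hf : f₁ = f₂) {ν₁ : NormalField I f₁}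
    {ν₂ : NormalField I f₂} (hν : ∀ u, ν₁ u = ν₂ u) (y : N) :
    g.secondFundamentalForm I' f₁ ν₁ y = g.secondFundamentalForm I' f₂ ν₂ y := by
  subst hf
  have : ν₁ = ν₂ := funext hν
  subst this
  rfl

end Generic

section Chart

variable {E : Type*} [NormedAddCommGroup E] [NormedSpace ℝ E] [FiniteDimensional ℝ E]
  {U : Opens E} {n : ℕ∞ω}
  {g : PseudoRiemannianMetric 𝓘(ℝ, E) n E (TangentSpace 𝓘(ℝ, E) : U → Type _)}
  {G : E → E →L[ℝ] E →L[ℝ] ℝ}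

/-- **Expanding the Christoffel term of the chart formula**: if `g = G` at `x`, then
`g_x(F + Γ_x(Y)(X), W) = G(x)(F, W) + ½ 𝒦_G(x)(Y; X, W)` (`two_mul_val_christoffel`), a
metric-free expression in the `1`-jet of the components. [cite: ONeill1983, Ch. 3, Prop. 3.13] -/
theorem val_add_christoffel_eq (x : U) (hG : g.val x = G x) (F Y X W : E) :
    g.val x (F + OpensChart.christoffel g G x Y X) W =
      G x F W + 2⁻¹ * OpensChart.koszulForm G x Y X W := by
  have h2 := OpensChart.two_mul_val_christoffel (g := g) (G := G) x Y X W
  have hadd : g.val x (F + OpensChart.christoffel g G x Y X) W =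
      g.val x F W + g.val x (OpensChart.christoffel g G x Y X) W :=
    congrArg (fun T : E →L[ℝ] ℝ => T W) ((g.val x).map_add F (OpensChart.christoffel g G x Y X))
  have h3 : g.val x F W = G x F W := congrArg (fun T : E →L[ℝ] E →L[ℝ] ℝ => T F W) hG
  rw [hadd, h3, ← h2]
  ring

end Chart

/-! ### Two norm lemmas (used by the development side) -/

/-- A continuous linear injection out of `E4` is bounded below. [folklore] -/
theorem exists_bound_of_injective {F : Type*} [NormedAddCommGroup F] [NormedSpace ℝ F]
    (T : E4 →L[ℝ] F) (hT : Injective T) : ∃ c : ℝ, 0 < c ∧ ∀ v : E4, c * ‖v‖ ≤ ‖T v‖ := by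
  obtain ⟨K, hK, hA⟩ := (LinearMap.injective_iff_antilipschitz (T : E4 →ₗ[ℝ] F)).1 hT
  refine ⟨(K : ℝ)⁻¹, by positivity, fun v => ?_⟩
  have h := hA.le_mul_dist v 0
  simp only [dist_zero_right, ContinuousLinearMap.coe_coe, map_zero] at h
  rw [inv_mul_le_iff₀ (by exact_mod_cast hK)]
  exact h

/-- A form close to a form bounded below by `c` is nondegenerate (`‖T − T₀‖ < c`). [folklore] -/
theorem nondegenerate_of_norm_sub_lt {T T₀ : E4 →L[ℝ] E4 →L[ℝ] ℝ} {c : ℝ}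
    (hc : ∀ v : E4, c * ‖v‖ ≤ ‖T₀ v‖) (h : ‖T - T₀‖ < c) (v : E4) (hv : ∀ w, T v w = 0) : v = 0 := by
  by_contra hne
  have hvpos : 0 < ‖v‖ := norm_pos_iff.2 hne
  have hTv : T v = 0 := ContinuousLinearMap.ext fun w => by rw [hv w]; rfl
  have h1 : ‖T₀ v‖ ≤ ‖T - T₀‖ * ‖v‖ := by
    have : T₀ v = -((T - T₀) v) := by
      rw [sub_apply, hTv, zero_sub, neg_neg]
    rw [this, norm_neg]
    exact (T - T₀).le_opNorm v
  have h2 : c * ‖v‖ ≤ ‖T - T₀‖ * ‖v‖ := (hc v).trans h1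
  have := lt_of_le_of_lt (le_of_mul_le_mul_right h2 hvpos) h
  exact lt_irrefl _ this

/-! ### The Kerr slab second fundamental form in boosted coordinates -/

/-- `Λ⁻¹((Λ z + c) − c) = z` (local copy of `poincareInv_lab` of the factorisation module, which is
landed in parallel). [folklore] -/
private theorem poincareInv_lab₁ (mo : lorentzGroup × E4) (z : E4) :
    poincareInv mo.1 mo.2 ((mo.1 : E4 ≃L[ℝ] E4) z + mo.2) = z := by
  simp [poincareInv]

set_option synthInstance.maxHeartbeats 400000 in
set_option maxHeartbeats 1600000 in
/-- **The Kerr slab second fundamental form in the boosted chart.**  For `0 < M` and `B` the star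
background boosted by `(Λ, c)`, at a point `y` of the open slab and on `v, w ∈ E3`:
`K_{ν_N}(ψ_N)(y)(v, w) = g_B(x)(D(Λ N)(y) v, Λ(0,w)) + ½ 𝒦_{g_B}(x)(Λ N(y); Λ(0,v), Λ(0,w))`,
`x = Λ(0,y) + c`, `N = (1 + 2H)^{-1/2} V` the Kerr–Schild slice normal representative.  Naturality of
`K` under reparametrisation of the source and under the Poincaré isometry of `B.domain` onto the star
chart, then the chart formula. [cite: ONeill1983, Ch. 4, Lemma 4.1] -/
theorem kerrSlab_secondFundamentalForm_chart [Kerr.Facts] [Kerr.SliceFacts] (M a : ℝ)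
    (mo : lorentzGroup × E4) (B : ModelBackground) (hM : 0 < M)
    (hB : B = starBackground mo.1 mo.2 M a (fun x => Kerr.radius a (poincareInv mo.1 mo.2 x)))
    [(Kerr.smoothMetric M a M).HasLeviCivita] (y : slabW M a) (v w : E3) :
    (Kerr.smoothMetric M a M).secondFundamentalForm 𝓘(ℝ, E3) (ψN M a) (νN M a) y v w =
      B.bilin ((mo.1 : E4 ≃L[ℝ] E4) (E4.ofTimeSpace 0 (y : E3)) + mo.2)
          (fderiv ℝ (fun z : E3 => (mo.1 : E4 ≃L[ℝ] E4)
            ((√(1 + 2 * Kerr.scalarH M a (E4.ofTimeSpace 0 z)))⁻¹ •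
              Kerr.timeVector M a (E4.ofTimeSpace 0 z))) (y : E3) v)
          ((mo.1 : E4 ≃L[ℝ] E4) (E4.spaceEmbed w)) +
        2⁻¹ * OpensChart.koszulForm B.bilin ((mo.1 : E4 ≃L[ℝ] E4) (E4.ofTimeSpace 0 (y : E3)) + mo.2)
          ((mo.1 : E4 ≃L[ℝ] E4) ((√(1 + 2 * Kerr.scalarH M a (E4.ofTimeSpace 0 (y : E3))))⁻¹ •
            Kerr.timeVector M a (E4.ofTimeSpace 0 (y : E3))))
          ((mo.1 : E4 ≃L[ℝ] E4) (E4.spaceEmbed v)) ((mo.1 : E4 ≃L[ℝ] E4) (E4.spaceEmbed w)) := by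
  /- ## notation and elementary facts -/
  set Λ : E4 ≃L[ℝ] E4 := (mo.1 : E4 ≃L[ℝ] E4) with hΛ
  set NK : E3 → E4 := fun z => (√(1 + 2 * Kerr.scalarH M a (E4.ofTimeSpace 0 z)))⁻¹ •
    Kerr.timeVector M a (E4.ofTimeSpace 0 z) with hNK
  set P : E4 → E4 := poincareInv mo.1 mo.2 with hP
  have hdom : (B.domain : Set E4) = P ⁻¹' (Kerr.region a M : Set E4) := by rw [hB]; rfl
  have hbil : B.bilin = boostedKerrBilin mo.1 mo.2 M a := by rw [hB]; rfl
  have hPreg : ∀ x : B.domain, P x.1 ∈ Kerr.region a M := fun x => by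
    have hx : (x.1 : E4) ∈ (B.domain : Set E4) := x.2
    rw [hdom] at hx
    exact hx
  set A : E3 → E4 := fun z => Λ (E4.ofTimeSpace 0 z) + mo.2 with hA
  have hPA : ∀ z, P (A z) = E4.ofTimeSpace 0 z := fun z => poincareInv_lab₁ mo _
  have hAd : ∀ z, HasFDerivAt A ((Λ : E4 →L[ℝ] E4).comp E4.spaceEmbed) z :=
    fun z => ((Λ : E4 →L[ℝ] E4).hasFDerivAt.comp z (E4.hasFDerivAt_ofTimeSpace 0 z)).add_const mo.2
  have hmem : ∀ z : E3, z ∈ Kerr.slice a M → A z ∈ B.domain := fun z hz => by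
    show A z ∈ (B.domain : Set E4)
    rw [hdom, mem_preimage, hPA]
    exact Kerr.mem_slice_iff_ofTimeSpace_mem_region.1 hz
  /- ## the source chart domain `{M < r(0,·) < 3M} ⊆ E3` and the reparametrisation `Θ'` -/
  set SN : Opens E3 := ⟨{z | max M 0 < Kerr.radius a (E4.ofTimeSpace 0 z) ∧
      Kerr.radius a (E4.ofTimeSpace 0 z) < 3 * M},
    (isOpen_lt continuous_const ((Kerr.continuous_radius a).comp (E4.continuous_ofTimeSpace 0))).inter
      (isOpen_lt ((Kerr.continuous_radius a).comp (E4.continuous_ofTimeSpace 0)) continuous_const)⟩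
    with hSN
  have hu₀mem : (y : E3) ∈ SN := ⟨y.1.2, y.2⟩
  set u₀ : SN := ⟨(y : E3), hu₀mem⟩ with hu₀
  set Θ' : SN → slabW M a := fun u => ⟨⟨u.1, u.2.1⟩, u.2.2⟩ with hΘ'
  have hΘ's : ContMDiff 𝓘(ℝ, E3) 𝓘(ℝ, E3) ∞ Θ' := by
    have h1 : ContMDiff 𝓘(ℝ, E3) 𝓘(ℝ, E3) ∞ (fun u : SN => (⟨u.1, u.2.1⟩ : Kerr.slice a M)) := by
      rw [← ContMDiff.subtypeVal_comp_iff]; exact contMDiff_subtype_val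
    rw [← ContMDiff.subtypeVal_comp_iff]; exact h1
  have hΘ'mf : ∀ (u : SN) (v' : E3), mfderiv 𝓘(ℝ, E3) 𝓘(ℝ, E3) Θ' u v' = v' := by
    intro u v'
    have hd0 : MDifferentiableAt 𝓘(ℝ, E3) 𝓘(ℝ, E3) (Subtype.val : SN → E3) u :=
      (contMDiff_subtype_val (n := ∞)).mdifferentiableAt (by simp)
    have hd1 : MDifferentiableAt 𝓘(ℝ, E3) 𝓘(ℝ, E3)
        (fun u : SN => (⟨u.1, u.2.1⟩ : Kerr.slice a M)) u :=
      OpensChart.mdifferentiableAt_codRestrict (U' := Kerr.slice a M)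
        (φ := fun u : SN => (⟨u.1, u.2.1⟩ : Kerr.slice a M))
        (f := (Subtype.val : SN → E3)) (fun _ => rfl) hd0
    rw [OpensChart.mfderiv_codRestrict (U' := slabW M a) (φ := Θ')
        (f := fun u : SN => (⟨u.1, u.2.1⟩ : Kerr.slice a M)) (fun _ => rfl) hd1,
      OpensChart.mfderiv_codRestrict (U' := Kerr.slice a M)
        (φ := fun u : SN => (⟨u.1, u.2.1⟩ : Kerr.slice a M))
        (f := (Subtype.val : SN → E3)) (fun _ => rfl) hd0,
      mfderiv_subtypeVal]
    rfl
  have hΘ'd : ∀ u : SN, MDifferentiableAt 𝓘(ℝ, E3) 𝓘(ℝ, E3) Θ' u := fun u =>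
    (hΘ's u).mdifferentiableAt (by simp)
  set eNB : SN → B.domain := fun u => ⟨A u.1, hmem u.1 u.2.1⟩ with heNB
  have heNBval : ∀ u : SN, (eNB u : E4) = A u.1 := fun u => rfl
  set ν₂ : SN → E4 := fun u => Λ (NK u.1) with hν₂
  have hAdiff : ∀ u : SN, DifferentiableAt ℝ A u.1 := fun u => (hAd _).differentiableAt
  have hNKdiff : ∀ u : SN, DifferentiableAt ℝ (fun z => Λ (NK z)) u.1 := fun u => by
    have hr0 : 0 < Kerr.radius a (E4.ofTimeSpace 0 (u.1 : E3)) :=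
      Kerr.radius_pos_of_mem_region (Kerr.mem_slice_iff_ofTimeSpace_mem_region.1 u.2.1)
    exact ((Λ : E4 →L[ℝ] E4).differentiableAt).comp _
      ((Kerr.contDiffAt_sliceNormalRep hM.le a hr0 (n := 1)).differentiableAt one_ne_zero)
  /- ## the Poincaré isometry `P̂ : B.domain → Kerr.region` and the pulled-back metric `g_B` -/
  set gK := (Kerr.smoothMetric M a M).toPseudoRiemannianMetric with hgK
  set Pr : B.domain → Kerr.region a M := fun x => ⟨P x.1, hPreg x⟩ with hPr
  have hPrs0 : ContMDiff 𝓘(ℝ, E4) 𝓘(ℝ, E4) ∞ Pr := by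
    rw [← ContMDiff.subtypeVal_comp_iff]
    intro x
    exact contMDiffAt_subtype_iff.2
      (KerrSchildChart.contDiff_poincareInv mo.1 mo.2).contMDiff.contMDiffAt
  have hPrs : ContMDiff 𝓘(ℝ, E4) 𝓘(ℝ, E4) ((((⊤ : ℕ∞) : WithTop ℕ∞)) + 1) Pr := hPrs0
  have hdPr : ∀ x : B.domain, mfderiv 𝓘(ℝ, E4) 𝓘(ℝ, E4) Pr x = (Λ.symm : E4 →L[ℝ] E4) := by
    intro x
    have h1 : MDifferentiableAt 𝓘(ℝ, E4) 𝓘(ℝ, E4) (fun x : B.domain => P x.1) x := by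
      have := (KerrSchildChart.contDiff_poincareInv mo.1 mo.2 (n := ∞)).contMDiff.contMDiffAt (x := x.1)
      exact (contMDiffAt_subtype_iff.2 this).mdifferentiableAt (by simp)
    rw [OpensChart.mfderiv_codRestrict (U' := Kerr.region a M) (φ := Pr)
      (f := fun x : B.domain => P x.1) (fun _ => rfl) h1]
    rw [show (fun x : B.domain => P x.1) = P ∘ Subtype.val from rfl,
      mfderiv_comp_subtypeVal (((KerrSchildChart.contDiff_poincareInv mo.1 mo.2
        (n := ∞)).contMDiff.contMDiffAt (x := x.1)).mdifferentiableAt (by simp)), mfderiv_eq_fderiv,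
      KerrSchildChart.fderiv_poincareInv]
  have hPr' : ∀ x : B.domain, Injective (mfderiv 𝓘(ℝ, E4) 𝓘(ℝ, E4) Pr x) := fun x => by
    rw [hdPr]; exact Λ.symm.injective
  set gB := gK.comap PseudoRiemannianMetric.contMDiff_pullbackBilin_holds Pr hPrs hPr' rfl with hgB
  haveI hgBLC : gB.HasLeviCivita := gB.hasLeviCivita
  have hGB : ∀ x : B.domain, gB.val x = B.bilin x.1 := fun x => by
    have e : ∀ u u' : E4, gB.val x u u' = B.bilin x.1 u u' := fun u u' => by
      rw [hgB, PseudoRiemannianMetric.val_comap, pullbackBilin_apply, hdPr, hgK, Kerr.smoothMetric_val,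
        hbil, boostedKerrBilin_apply]
      rfl
    exact ContinuousLinearMap.ext fun u => ContinuousLinearMap.ext fun u' => e u u'
  /- ## naturality: reparametrise over `SN`, transport through `P̂`, read in the chart -/
  have h_locK : gK.secondFundamentalForm 𝓘(ℝ, E3) (ψN M a) (νN M a) y v w =
      gK.secondFundamentalForm 𝓘(ℝ, E3) (ψN M a ∘ Θ') (fun u => νN M a (Θ' u)) u₀ v w := by
    have hνK : MDifferentiableAt 𝓘(ℝ, E3) 𝓘(ℝ, E4).tangent
        (fun x => (TotalSpace.mk' E4 (ψN M a x) (νN M a x) : TangentBundle 𝓘(ℝ, E4) (Kerr.region a M)))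
        (Θ' u₀) := by
      have h := (Kerr.dataEmbedding M a M hM.le).mdifferentiableAt_embed_normal (Θ' u₀).1
      exact h.comp (Θ' u₀) ((contMDiff_subtype_val (n := ∞)).mdifferentiableAt (by simp))
    have h1 := gK.secondFundamentalForm_comp_right (IX := 𝓘(ℝ, E3)) (IN := 𝓘(ℝ, E3))
      (f := ψN M a) (ν := νN M a) (Ψ := Θ') (u := u₀)
      BoundarylessManifold.isInteriorPoint BoundarylessManifold.isInteriorPoint hνK (hΘ'd u₀) v w
    rw [hΘ'mf, hΘ'mf] at h1
    exact h1.symm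
  have h_congrK : gK.secondFundamentalForm 𝓘(ℝ, E3) (ψN M a ∘ Θ') (fun u => νN M a (Θ' u)) u₀ =
      gK.secondFundamentalForm 𝓘(ℝ, E3) (Pr ∘ eNB)
        (fun u => mfderiv 𝓘(ℝ, E4) 𝓘(ℝ, E4) Pr (eNB u) (ν₂ u)) u₀ := by
    refine secondFundamentalForm_congr_pair gK 𝓘(ℝ, E3) (funext fun u => Subtype.ext ?_) (fun u => ?_) u₀
    · show E4.ofTimeSpace 0 (u.1 : E3) = P (A u.1)
      rw [hPA]
    · show (νN M a (Θ' u) : E4) = mfderiv 𝓘(ℝ, E4) 𝓘(ℝ, E4) Pr (eNB u) (Λ (NK u.1))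
      rw [hdPr]
      show NK u.1 = Λ.symm (Λ (NK u.1))
      rw [ContinuousLinearEquiv.symm_apply_apply]
  have hνliftB : MDifferentiableAt 𝓘(ℝ, E3) 𝓘(ℝ, E4).tangent
      (fun u => (TotalSpace.mk' E4 (eNB u) (ν₂ u) : TangentBundle 𝓘(ℝ, E4) B.domain)) u₀ :=
    OpensChart.mdifferentiableAt_lift_of_repr (f := eNB) (Φ := A) heNBval (ν := ν₂)
      (N := fun z => Λ (NK z)) (fun _ => rfl) (hAdiff u₀) (hNKdiff u₀)
  have h_comapK : gK.secondFundamentalForm 𝓘(ℝ, E3) (Pr ∘ eNB)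
        (fun u => mfderiv 𝓘(ℝ, E4) 𝓘(ℝ, E4) Pr (eNB u) (ν₂ u)) u₀ =
      gB.secondFundamentalForm 𝓘(ℝ, E3) eNB ν₂ u₀ :=
    (gK.secondFundamentalForm_comap PseudoRiemannianMetric.contMDiff_pullbackBilin_holds hPrs hPr' rfl
      (f := eNB) (ν := ν₂) BoundarylessManifold.isInteriorPoint hνliftB).symm
  have hBd : DifferentiableAt ℝ B.bilin (eNB u₀ : E4) := by
    have hr : 0 < Kerr.radius a (poincareInv mo.1 mo.2 (eNB u₀ : E4)) :=
      Kerr.radius_pos_of_mem_region (hPreg (eNB u₀))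
    rw [hbil]
    exact (contDiffAt_boostedKerrBilin _ _ _ _ hr (n := 1)).differentiableAt one_ne_zero
  have h_chartK : gB.secondFundamentalForm 𝓘(ℝ, E3) eNB ν₂ u₀ v w =
      gB.val (eNB u₀) (fderiv ℝ (fun z => Λ (NK z)) (y : E3) v +
        OpensChart.christoffel gB B.bilin (eNB u₀) (Λ (NK (y : E3))) (fderiv ℝ A (y : E3) v))
        (fderiv ℝ A (y : E3) w) :=
    OpensChart.secondFundamentalForm_eq_of_repr (g := gB) (G := B.bilin) hGB (f := eNB) (Φ := A)
      heNBval (ν := ν₂) (N := fun z => Λ (NK z)) (fun _ => rfl) (hAdiff u₀) (hNKdiff u₀) hBd v w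
  -- assemble and expand the Christoffel term
  rw [h_locK, congrArg (fun K => K v w) h_congrK, congrArg (fun K => K v w) h_comapK, h_chartK,
    val_add_christoffel_eq (eNB u₀) (hGB (eNB u₀)), (hAd _).fderiv]
  rfl

end F1Route

open F1Route in
/-- **Registered bookkeeping sub-goal `stub_kerrSlabSecondFormChart` of the line** (brick of the
landing of F1' `stub_slabCauchyRigidity'`): the Kerr slab second fundamental form in the coordinates
of a boosted star background, as a metric-free expression in the `1`-jet of the background
components at the slab point. [cite: ONeill1983, Ch. 4, Lemma 4.1] -/
theorem stub_kerrSlabSecondFormChart : ∀ [Kerr.Facts] [Kerr.SliceFacts] (M a : ℝ)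
    (mo : lorentzGroup × E4) (B : ModelBackground), 0 < M →
    B = starBackground mo.1 mo.2 M a (fun x => Kerr.radius a (poincareInv mo.1 mo.2 x)) →
    ∀ [(Kerr.smoothMetric M a M).HasLeviCivita] (y : F1Route.slabW M a) (v w : E3),
    (Kerr.smoothMetric M a M).secondFundamentalForm 𝓘(ℝ, E3) (F1Route.ψN M a) (F1Route.νN M a) y v w =
      B.bilin ((mo.1 : E4 ≃L[ℝ] E4) (E4.ofTimeSpace 0 (y : E3)) + mo.2)
          (fderiv ℝ (fun z : E3 => (mo.1 : E4 ≃L[ℝ] E4)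
            ((√(1 + 2 * Kerr.scalarH M a (E4.ofTimeSpace 0 z)))⁻¹ •
              Kerr.timeVector M a (E4.ofTimeSpace 0 z))) (y : E3) v)
          ((mo.1 : E4 ≃L[ℝ] E4) (E4.spaceEmbed w)) +
        2⁻¹ * OpensChart.koszulForm B.bilin ((mo.1 : E4 ≃L[ℝ] E4) (E4.ofTimeSpace 0 (y : E3)) + mo.2)
          ((mo.1 : E4 ≃L[ℝ] E4) ((√(1 + 2 * Kerr.scalarH M a (E4.ofTimeSpace 0 (y : E3))))⁻¹ •
            Kerr.timeVector M a (E4.ofTimeSpace 0 (y : E3))))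
          ((mo.1 : E4 ≃L[ℝ] E4) (E4.spaceEmbed v)) ((mo.1 : E4 ≃L[ℝ] E4) (E4.spaceEmbed w)) :=
  fun M a mo B hM hB _ y v w => kerrSlab_secondFundamentalForm_chart M a mo B hM hB y v w

end Summit.FinalStateConjecture.FinalStateConjecture.Theorems.BondiBartnikRigidity.DirectMethod

end
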